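import Literature.NumberTheory.Automorphic.ArchKirillovODEGL2ComplexLowest
import Literature.NumberTheory.Automorphic.ArchKirillovODEGL2ComplexKType
import Literature.NumberTheory.Automorphic.ArchKTypeWeightVector
import HarnessLib

/-!
# The `SU(2)`-string of a highest-weight Gårding vector of `GL₂(K_∞)` at a complex place, and the
# downward recursion of its Kirillov functions (Jacquet–Langlands (1970), §6)

Topic `NumberTheory/Automorphic`; namespace `Literature.NumberTheory.Automorphic`. Theorems only (no
definition, no named fact, no instance). Notation at a complex place `w`: `τ^h(E_{ij})`, `τ^a(E_{ij})`
(twice the holomorphic / antiholomorphic parts of `τ`), `T = (E₀₀ - E₁₁) ⊗ i_w`,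
`E = τ^h(E₀₁) - τ^a(E₁₀)` (raising), `F = τ^h(E₁₀) - τ^a(E₀₁)` (lowering). Contents:

1. `gardingEndHol_comm_gardingEndAnti` — holomorphic and antiholomorphic letters commute;
   `raisingK_mul_loweringK` — `E F = F E + 2(τ^h(E₀₀) - τ^h(E₁₁)) - 2(τ^a(E₀₀) - τ^a(E₁₁))`;
   `holDiag_sub_antiDiag` — `(τ^h(E₀₀) - τ^h(E₁₁)) - (τ^a(E₀₀) - τ^a(E₁₁)) = -2i τ(T)`;
   `torusC_mul_loweringK` — `τ(T) F = F τ(T) - 2i F`; `raisingK_eq`, `loweringK_eq` (the `A/B` forms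
   of `ArchKTypeWeightVector`).
2. The string `v_j = F^j x` of a highest-weight vector `x` (`E x = 0`, `τ(T) x = im x`):
   `torusC_loweringK_pow_apply` (`τ(T) v_j = i(m - 2j) v_j`) and the **`𝔰𝔩₂` string identity**
   `raisingK_loweringK_pow_succ_apply` (`E v_{j+1} = 4(j+1)(m-j) v_j`).
3. `kirillovODE_complex_string_down` — the Kirillov ODE of a string member `v` of torus weight `m'`
   with `F v = u`, generalising `ArchKirillovODEGL2ComplexLowest.kirillovODE_complex_lowest` (`u = 0`):

     `2 f₂ - (2μ₁ - 2m' + 4) f₁ + (μ₁² - iμ₁μ₂ - μ₂²/2 + 2μ₁ + m'²/2 - μ₁ m' - 2m' - λ_h) f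
        + 2 θ^h θ^a e^{2y} f + 2 θ^h e^y f_u = 0`,

   `f(y) = ℓ(τ(exp yH) v)`, `f_u(y) = ℓ(τ(exp yH) u)`, `θ^h = θ₁ - iθ₂`, `θ^a = θ₁ + iθ₂`.

## References

* H. Jacquet, R. P. Langlands, *Automorphic Forms on GL(2)*, LNM 114 (1970), §6. [JacquetLanglands1970]
* A. W. Knapp, *Representation Theory of Semisimple Groups* (1986), Ch. II §5, Ch. VIII §3. [Knapp1986]
-/

noncomputable section

open MeasureTheory Measure NumberField NumberField.InfinitePlace NumberField.mixedEmbedding IsDedekindDomain Set Filter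
open scoped MatrixGroups Topology Classical

namespace Literature.NumberTheory.Automorphic

variable {K : Type} [Field K] [NumberField K]

-- as in `ArchGardingWhittaker`
set_option backward.isDefEq.respectTransparency false

section Place

variable {hcpt : isCompact_glFiniteIntegralLevel 2 K}
  {E : Type*} [NormedAddCommGroup E] [NormedSpace ℂ E] [CompleteSpace E]
  {τ : ContRepresentation ℂ (AutomorphyDatum.gl 2 K hcpt).arch.carrier E}
  (hτ : τ.IsStronglyContinuous) (w : {w : InfinitePlace K // IsComplex w})

local notation "𝐜" => ((0, Pi.single w 1) : mixedSpace K)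
local notation "𝐜I" => ((0, Pi.single w Complex.I) : mixedSpace K)
local notation "Hc" => Matrix.single (0 : Fin 2) (0 : Fin 2) ((0, Pi.single w 1) : mixedSpace K)
local notation "D" => gardingEnd (hcpt := hcpt) (τ := τ) hτ
local notation "A[" y "]" => gardingAct (hcpt := hcpt) (τ := τ) hτ (expGL ((y : ℝ) • Hc))
local notation "Dh[" i "," j "]" => (gardingEnd (hcpt := hcpt) (τ := τ) hτ (Matrix.single (i : Fin 2) (j : Fin 2) ((0, Pi.single w 1) : mixedSpace K)) -
  Complex.I • gardingEnd (hcpt := hcpt) (τ := τ) hτ (Matrix.single (i : Fin 2) (j : Fin 2) ((0, Pi.single w Complex.I) : mixedSpace K)))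
local notation "Da[" i "," j "]" => (gardingEnd (hcpt := hcpt) (τ := τ) hτ (Matrix.single (i : Fin 2) (j : Fin 2) ((0, Pi.single w 1) : mixedSpace K)) +
  Complex.I • gardingEnd (hcpt := hcpt) (τ := τ) hτ (Matrix.single (i : Fin 2) (j : Fin 2) ((0, Pi.single w Complex.I) : mixedSpace K)))
local notation "Tc" => (Matrix.single (0 : Fin 2) (0 : Fin 2) ((0, Pi.single w Complex.I) : mixedSpace K) -
  Matrix.single (1 : Fin 2) (1 : Fin 2) ((0, Pi.single w Complex.I) : mixedSpace K))

/-! ### 1. Operator identities -/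

/-- **Holomorphic and antiholomorphic letters commute**: `τ^h(E_{ij}) τ^a(E_{kl}) = τ^a(E_{kl}) τ^h(E_{ij})`
(the real brackets `[E_{ij} ⊗ c, E_{kl} ⊗ c] + [E_{ij} ⊗ ic, E_{kl} ⊗ ic] = 0` and
`[E_{ij} ⊗ c, E_{kl} ⊗ ic] = [E_{ij} ⊗ ic, E_{kl} ⊗ c]`). [cite: Knapp1986, Ch. VIII §3] -/
theorem gardingEndHol_comm_gardingEndAnti (i j k l : Fin 2) : Dh[i,j] * Da[k,l] = Da[k,l] * Dh[i,j] := by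
  have hcc := complexIdem_mul_self (K := K) w
  have hci := complexIdem_mul_complexIdemI (K := K) w
  have hic := complexIdemI_mul_complexIdem (K := K) w
  have hii := complexIdemI_mul_self (K := K) w
  -- the four real brackets, as matrices
  have key : ∀ x y : mixedSpace K, D (Matrix.single i j x) * D (Matrix.single k l y) =
      D (Matrix.single k l y) * D (Matrix.single i j x) + D (Matrix.single i j x * Matrix.single k l y - Matrix.single k l y * Matrix.single i j x) :=
    fun x y => gardingEnd_mul_eq hτ _ _
  have hoff := single_mul_single_off (K := K)
  have m1 : Matrix.single i j 𝐜 * Matrix.single k l 𝐜 - Matrix.single k l 𝐜 * Matrix.single i j 𝐜 +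
      (Matrix.single i j 𝐜I * Matrix.single k l 𝐜I - Matrix.single k l 𝐜I * Matrix.single i j 𝐜I) = 0 := by
    fin_cases i <;> fin_cases j <;> fin_cases k <;> fin_cases l
    all_goals
      simp only [Fin.zero_eta, Fin.mk_one, Matrix.single_mul_single_same, (hoff _ _ _ _).1, (hoff _ _ _ _).2, hcc, hii,
        ← Matrix.single_neg]
      try abel
  have m2 : Matrix.single i j 𝐜 * Matrix.single k l 𝐜I - Matrix.single k l 𝐜I * Matrix.single i j 𝐜 =
      Matrix.single i j 𝐜I * Matrix.single k l 𝐜 - Matrix.single k l 𝐜 * Matrix.single i j 𝐜I := by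
    fin_cases i <;> fin_cases j <;> fin_cases k <;> fin_cases l
    all_goals
      simp only [Fin.zero_eta, Fin.mk_one, Matrix.single_mul_single_same, (hoff _ _ _ _).1, (hoff _ _ _ _).2, hci, hic]
  -- expand
  have e1 := key 𝐜 𝐜
  have e2 := key 𝐜 𝐜I
  have e3 := key 𝐜I 𝐜
  have e4 := key 𝐜I 𝐜I
  have hsum : D (Matrix.single i j 𝐜 * Matrix.single k l 𝐜 - Matrix.single k l 𝐜 * Matrix.single i j 𝐜) +
      D (Matrix.single i j 𝐜I * Matrix.single k l 𝐜I - Matrix.single k l 𝐜I * Matrix.single i j 𝐜I) = 0 := by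
    rw [← gardingEnd_add, m1, gardingEnd_zero]
  have hdiff : D (Matrix.single i j 𝐜 * Matrix.single k l 𝐜I - Matrix.single k l 𝐜I * Matrix.single i j 𝐜) =
      D (Matrix.single i j 𝐜I * Matrix.single k l 𝐜 - Matrix.single k l 𝐜 * Matrix.single i j 𝐜I) := by rw [m2]
  rw [sub_mul, mul_add, mul_add, smul_mul_assoc, smul_mul_assoc, mul_smul_comm, mul_smul_comm, e1, e2, e3, e4, hdiff,
    add_mul, mul_sub, mul_sub, smul_mul_assoc, smul_mul_assoc, mul_smul_comm, mul_smul_comm]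
  have hI : Complex.I * Complex.I = -1 := Complex.I_mul_I
  simp only [smul_add, smul_smul, hI, neg_smul, one_smul]
  have h' := hsum
  rw [add_eq_zero_iff_eq_neg] at h'
  rw [h']
  abel

/-- The raising and lowering operators in the `A/B` form of `ArchKTypeWeightVector`:
`τ^h(E₀₁) - τ^a(E₁₀) = τ(A) - iτ(B)`, `τ^h(E₁₀) - τ^a(E₀₁) = -τ(A) - iτ(B)` with
`A = (E₀₁ - E₁₀) ⊗ c`, `B = (E₀₁ + E₁₀) ⊗ ic`. [folklore] -/
theorem raisingK_loweringK_eq :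
    (Dh[0,1] - Da[1,0] = D (Matrix.single 0 1 𝐜 - Matrix.single 1 0 𝐜) - Complex.I • D (Matrix.single 0 1 𝐜I + Matrix.single 1 0 𝐜I)) ∧
    (Dh[1,0] - Da[0,1] = -D (Matrix.single 0 1 𝐜 - Matrix.single 1 0 𝐜) - Complex.I • D (Matrix.single 0 1 𝐜I + Matrix.single 1 0 𝐜I)) := by
  refine ⟨?_, ?_⟩ <;> rw [gardingEnd_sub, gardingEnd_add, smul_add] <;> abel

/-- **`E F = F E + 2(τ^h(E₀₀) - τ^h(E₁₁)) - 2(τ^a(E₀₀) - τ^a(E₁₁))`.** [cite: Knapp1986, Ch. II §5] -/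
theorem raisingK_mul_loweringK :
    (Dh[0,1] - Da[1,0]) * (Dh[1,0] - Da[0,1]) =
      (Dh[1,0] - Da[0,1]) * (Dh[0,1] - Da[1,0]) + (2 : ℂ) • (Dh[0,0] - Dh[1,1]) - (2 : ℂ) • (Da[0,0] - Da[1,1]) := by
  have hh : Dh[0,1] * Dh[1,0] - Dh[1,0] * Dh[0,1] = (2 : ℂ) • (Dh[0,0] - Dh[1,1]) := gardingEndHol_xPlus_comm_xMinus hτ w
  have ha : Da[0,1] * Da[1,0] - Da[1,0] * Da[0,1] = (2 : ℂ) • (Da[0,0] - Da[1,1]) := gardingEndAnti_xPlus_comm_xMinus hτ w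
  have c1 : Dh[0,1] * Da[0,1] = Da[0,1] * Dh[0,1] := gardingEndHol_comm_gardingEndAnti hτ w 0 1 0 1
  have c2 : Dh[1,0] * Da[1,0] = Da[1,0] * Dh[1,0] := gardingEndHol_comm_gardingEndAnti hτ w 1 0 1 0
  -- atoms
  set Ph : Module.End ℂ (archGardingSpace hcpt τ) := Dh[0,1]
  set Mh : Module.End ℂ (archGardingSpace hcpt τ) := Dh[1,0]
  set P : Module.End ℂ (archGardingSpace hcpt τ) := Da[0,1]
  set M : Module.End ℂ (archGardingSpace hcpt τ) := Da[1,0]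
  set Hh : Module.End ℂ (archGardingSpace hcpt τ) := Dh[0,0] - Dh[1,1]
  set Ha : Module.End ℂ (archGardingSpace hcpt τ) := Da[0,0] - Da[1,1]
  have hh' : Ph * Mh = Mh * Ph + (2 : ℂ) • Hh := by rw [← hh]; abel
  have ha' : M * P = P * M - (2 : ℂ) • Ha := by rw [← ha]; abel
  simp only [sub_mul, mul_sub]
  rw [hh', ha', c1, c2]
  abel

/-- **`(τ^h(E₀₀) - τ^h(E₁₁)) - (τ^a(E₀₀) - τ^a(E₁₁)) = -2i τ(T)`**, `T = (E₀₀ - E₁₁) ⊗ i_w`. [folklore] -/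
theorem holDiag_sub_antiDiag : (Dh[0,0] - Dh[1,1]) - (Da[0,0] - Da[1,1]) = (-2 * Complex.I) • D Tc := by
  rw [gardingEnd_sub]
  module

/-- **`τ(T) F = F τ(T) - 2i F`** for the lowering operator `F = τ^h(E₁₀) - τ^a(E₀₁)`. [folklore] -/
theorem torusC_mul_loweringK :
    D Tc * (Dh[1,0] - Da[0,1]) = (Dh[1,0] - Da[0,1]) * D Tc + (-2 * Complex.I) • (Dh[1,0] - Da[0,1]) := by
  rw [(raisingK_loweringK_eq hτ w).2]
  have h := torusC_mul_raising (hcpt := hcpt) (τ := τ) hτ w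
  -- `[T, A] = 2B`, `[T, B] = -2A` on the Gårding space, read off from `torusC_mul_raising` and its conjugate
  -- form; we redo the bracket computation directly
  have hoff := single_mul_single_off (K := K)
  have hcc := complexIdem_mul_complexIdemI (K := K) w
  have hcc' := complexIdemI_mul_complexIdem (K := K) w
  have hii := complexIdemI_mul_self (K := K) w
  have hTA : ((Matrix.single 0 0 ((0, Pi.single w Complex.I) : mixedSpace K) - Matrix.single 1 1 ((0, Pi.single w Complex.I) : mixedSpace K)) *
        (Matrix.single 0 1 ((0, Pi.single w 1) : mixedSpace K) - Matrix.single 1 0 ((0, Pi.single w 1) : mixedSpace K)) -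
      (Matrix.single 0 1 ((0, Pi.single w 1) : mixedSpace K) - Matrix.single 1 0 ((0, Pi.single w 1) : mixedSpace K)) *
        (Matrix.single 0 0 ((0, Pi.single w Complex.I) : mixedSpace K) - Matrix.single 1 1 ((0, Pi.single w Complex.I) : mixedSpace K)) :
        Matrix (Fin 2) (Fin 2) (mixedSpace K)) =
      (2 : ℝ) • (Matrix.single 0 1 ((0, Pi.single w Complex.I) : mixedSpace K) + Matrix.single 1 0 ((0, Pi.single w Complex.I) : mixedSpace K)) := by
    simp only [mul_sub, sub_mul, Matrix.single_mul_single_same, (hoff _ _ _ _).1, (hoff _ _ _ _).2, hcc, hcc', two_smul]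
    abel
  have hTB : ((Matrix.single 0 0 ((0, Pi.single w Complex.I) : mixedSpace K) - Matrix.single 1 1 ((0, Pi.single w Complex.I) : mixedSpace K)) *
        (Matrix.single 0 1 ((0, Pi.single w Complex.I) : mixedSpace K) + Matrix.single 1 0 ((0, Pi.single w Complex.I) : mixedSpace K)) -
      (Matrix.single 0 1 ((0, Pi.single w Complex.I) : mixedSpace K) + Matrix.single 1 0 ((0, Pi.single w Complex.I) : mixedSpace K)) *
        (Matrix.single 0 0 ((0, Pi.single w Complex.I) : mixedSpace K) - Matrix.single 1 1 ((0, Pi.single w Complex.I) : mixedSpace K)) :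
        Matrix (Fin 2) (Fin 2) (mixedSpace K)) =
      (-2 : ℝ) • (Matrix.single 0 1 ((0, Pi.single w 1) : mixedSpace K) - Matrix.single 1 0 ((0, Pi.single w 1) : mixedSpace K)) := by
    simp only [mul_sub, sub_mul, mul_add, add_mul, Matrix.single_mul_single_same, (hoff _ _ _ _).1, (hoff _ _ _ _).2, hii,
      neg_smul, two_smul, ← Matrix.single_neg]
    abel
  have h1 := gardingEnd_mul_eq (hcpt := hcpt) (τ := τ) hτ Tc (Matrix.single 0 1 𝐜 - Matrix.single 1 0 𝐜)
  have h2 := gardingEnd_mul_eq (hcpt := hcpt) (τ := τ) hτ Tc (Matrix.single 0 1 𝐜I + Matrix.single 1 0 𝐜I)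
  rw [hTA, gardingEnd_smul] at h1
  rw [hTB, gardingEnd_smul] at h2
  clear h
  set T := D Tc
  set DA := D (Matrix.single 0 1 𝐜 - Matrix.single 1 0 𝐜)
  set DB := D (Matrix.single 0 1 𝐜I + Matrix.single 1 0 𝐜I)
  have hI3 : -2 * Complex.I * Complex.I = (((2 : ℝ) : ℂ)) := by
    rw [mul_assoc, Complex.I_mul_I]; push_cast; ring
  have e1 : T * DA = DA * T + (((2 : ℝ) : ℂ)) • DB := h1
  have e2 : T * DB = DB * T + (((-2 : ℝ) : ℂ)) • DA := h2
  have hn : -DA = (-1 : ℂ) • DA := (neg_one_smul ℂ DA).symm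
  rw [hn]
  simp only [mul_sub, sub_mul, mul_smul_comm, smul_mul_assoc, e1, e2, smul_add, smul_sub, smul_smul]
  push_cast
  rw [show Complex.I * -2 = -2 * Complex.I by ring, show -2 * Complex.I * Complex.I = 2 by rw [mul_assoc, Complex.I_mul_I]; ring,
    show -2 * Complex.I * -1 = 2 * Complex.I by ring]
  module

/-! ### 2. The string of a highest-weight vector -/

/-- **Weights along the string**: if `τ(T) x = im x` then `τ(T) (F^j x) = i(m - 2j) F^j x`. [cite: Knapp1986, Ch. II §5] -/
theorem torusC_loweringK_pow_apply (m : ℂ) (x : archGardingSpace hcpt τ) (hT : D Tc x = (Complex.I * m) • x) (j : ℕ) :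
    D Tc (((Dh[1,0] - Da[0,1]) ^ j) x) = (Complex.I * (m - 2 * j)) • ((Dh[1,0] - Da[0,1]) ^ j) x := by
  induction j with
  | zero => simpa using hT
  | succ j ih =>
    rw [pow_succ', Module.End.mul_apply, ← Module.End.mul_apply (f := D Tc), torusC_mul_loweringK hτ w, LinearMap.add_apply,
      Module.End.mul_apply, ih, map_smul, LinearMap.smul_apply, ← add_smul]
    congr 1
    push_cast
    ring

/-- **The `𝔰𝔩₂` string identity**: if `E x = 0` and `τ(T) x = im x` then
`E (F^{j+1} x) = 4(j+1)(m-j) F^j x` (`[E, F] = -4i τ(T)` acts on `F^j x` by `4(m - 2j)`).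
[cite: Knapp1986, Ch. II §5] -/
theorem raisingK_loweringK_pow_succ_apply (m : ℂ) (x : archGardingSpace hcpt τ)
    (hE : (Dh[0,1] - Da[1,0]) x = 0) (hT : D Tc x = (Complex.I * m) • x) (j : ℕ) :
    (Dh[0,1] - Da[1,0]) (((Dh[1,0] - Da[0,1]) ^ (j + 1)) x) = (4 * (j + 1) * (m - j)) • ((Dh[1,0] - Da[0,1]) ^ j) x := by
  have hEF := raisingK_mul_loweringK (hcpt := hcpt) (τ := τ) hτ w
  -- `E F = F E - 4i τ(T)` as operators
  have hEF' : (Dh[0,1] - Da[1,0]) * (Dh[1,0] - Da[0,1]) = (Dh[1,0] - Da[0,1]) * (Dh[0,1] - Da[1,0]) + (-4 * Complex.I) • D Tc := by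
    have hd := holDiag_sub_antiDiag (hcpt := hcpt) (τ := τ) hτ w
    rw [hEF]
    set FE := (Dh[1,0] - Da[0,1]) * (Dh[0,1] - Da[1,0])
    set Hh : Module.End ℂ (archGardingSpace hcpt τ) := Dh[0,0] - Dh[1,1]
    set Ha : Module.End ℂ (archGardingSpace hcpt τ) := Da[0,0] - Da[1,1]
    have e : FE + (2 : ℂ) • Hh - (2 : ℂ) • Ha = FE + (2 : ℂ) • (Hh - Ha) := by module
    rw [e, hd, smul_smul]
    congr 2
    ring
  -- one step: `E (F y) = F (E y) + 4(m - 2j) y` for `y = F^j x`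
  have hstep : ∀ j : ℕ, (Dh[0,1] - Da[1,0]) ((Dh[1,0] - Da[0,1]) (((Dh[1,0] - Da[0,1]) ^ j) x)) =
      (Dh[1,0] - Da[0,1]) ((Dh[0,1] - Da[1,0]) (((Dh[1,0] - Da[0,1]) ^ j) x)) + (4 * (m - 2 * j)) • ((Dh[1,0] - Da[0,1]) ^ j) x := by
    intro j
    have h := congrArg (fun S => S (((Dh[1,0] - Da[0,1]) ^ j) x)) hEF'
    simp only [Module.End.mul_apply, LinearMap.add_apply, LinearMap.smul_apply] at h
    rw [h, torusC_loweringK_pow_apply hτ w m x hT j, smul_smul]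
    congr 2
    have hI := Complex.I_sq
    linear_combination (-4 * (m - 2 * j)) * hI
  induction j with
  | zero =>
    have h0 := hstep 0
    rw [pow_zero, Module.End.one_apply, hE, map_zero, zero_add] at h0
    rw [zero_add, pow_one, pow_zero, Module.End.one_apply, h0]
    congr 1
    push_cast
    ring
  | succ j ih =>
    rw [pow_succ' _ (j + 1), Module.End.mul_apply, hstep (j + 1), ih, map_smul, ← Module.End.mul_apply (f := Dh[1,0] - Da[0,1]),
      ← pow_succ', ← add_smul]
    congr 1
    push_cast
    ring

/-! ### 3. The downward recursion of the Kirillov functions along the string -/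

/-- The holomorphic Casimir identity for a string member: as `placeCasimirHol_apply_of_lowest`, with
`τ^h(E₁₀) v = τ^a(E₀₁) v + u` (`u = F v` the next member) contributing `2 τ^h(E₀₁) u`. [cite: Knapp1986, Ch. VIII §3] -/
theorem placeCasimirHol_apply_of_string (z : ℂ) (v u : archGardingSpace hcpt τ)
    (hZ : Dh[0,0] v + Dh[1,1] v = z • v) (hM : Dh[1,0] v = Da[0,1] v + u) :
    ∑ i : Fin 2, ∑ j : Fin 2, Dh[i,j] (Dh[j,i] v) =
      (2 : ℂ) • Dh[0,0] (Dh[0,0] v) - (2 * z + 4) • Dh[0,0] v + (z ^ 2 + 2 * z) • v +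
        (2 : ℂ) • Dh[0,1] (Da[0,1] v) + (2 : ℂ) • Dh[0,1] u := by
  have hop : Dh[0,1] * Dh[1,0] - Dh[1,0] * Dh[0,1] = (2 : ℂ) • (Dh[0,0] - Dh[1,1]) :=
    gardingEndHol_xPlus_comm_xMinus hτ w
  have hcomm : Dh[1,1] * Dh[0,0] = Dh[0,0] * Dh[1,1] := gardingEndHol_hOne_mul_hZero hτ w
  rw [Fin.sum_univ_two, Fin.sum_univ_two, Fin.sum_univ_two]
  set H0 : Module.End ℂ (archGardingSpace hcpt τ) := Dh[0,0] with hH0d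
  set H1 : Module.End ℂ (archGardingSpace hcpt τ) := Dh[1,1] with hH1d
  set Ph : Module.End ℂ (archGardingSpace hcpt τ) := Dh[0,1] with hPhd
  set Mh : Module.End ℂ (archGardingSpace hcpt τ) := Dh[1,0] with hMhd
  set P : Module.End ℂ (archGardingSpace hcpt τ) := Da[0,1] with hPd
  have hH1 : H1 v = z • v - H0 v := by rw [← hZ]; abel
  have hc : H1 (H0 v) = H0 (H1 v) := by
    have h := congrArg (fun T => T v) hcomm
    simpa only [Module.End.mul_apply] using h
  have hH1sq : H1 (H1 v) = (z ^ 2) • v - (2 * z) • H0 v + H0 (H0 v) := by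
    conv_lhs => rw [hH1]
    rw [map_sub, map_smul, hH1, hc, hH1, map_sub, map_smul, smul_sub, pow_two, mul_smul, two_mul, add_smul]
    abel
  have hmp : Mh (Ph v) = Ph (Mh v) - (2 : ℂ) • (H0 v - H1 v) := by
    have h := congrArg (fun T => T v) hop
    simp only [LinearMap.sub_apply, Module.End.mul_apply, LinearMap.smul_apply] at h
    rw [← h]; abel
  rw [hmp, hM, map_add, hH1sq, hH1]
  module

/-- **The downward recursion of the Kirillov functions along an `SU(2)`-string at a complex place.**
For a Gårding vector `v` of torus weight `m'` (`τ(T) v = im' v`), central characters `μ₁, μ₂`,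
holomorphic Casimir eigenvalue `λ`, and `u = F v` (`F = τ^h(E₁₀) - τ^a(E₀₁)`):

  `2 f₂ - (2μ₁ - 2m' + 4) f₁ + (μ₁² - iμ₁μ₂ - μ₂²/2 + 2μ₁ + m'²/2 - μ₁ m' - 2m' - λ) f
     + 2 (θ₁ - iθ₂)(θ₁ + iθ₂) e^{2y} f + 2 (θ₁ - iθ₂) e^y f_u = 0`,

`f = ℓ(τ(exp yH) v)`, `f_u = ℓ(τ(exp yH) u)`. For `u = 0` this is `kirillovODE_complex_lowest`.
[cite: JacquetLanglands1970, §6] [cite: Knapp1986, Ch. VIII §3] -/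
theorem kirillovODE_complex_string_down {ℓ : archGardingSpace hcpt τ →ₗ[ℂ] ℂ} {θ₁ θ₂ : ℂ}
    (hθ₁ : ∀ u : archGardingSpace hcpt τ, ℓ (D (Matrix.single 0 1 𝐜) u) = θ₁ * ℓ u)
    (hθ₂ : ∀ u : archGardingSpace hcpt τ, ℓ (D (Matrix.single 0 1 𝐜I) u) = θ₂ * ℓ u)
    (μ₁ μ₂ m lam : ℂ) (v u : archGardingSpace hcpt τ)
    (hF : (Dh[1,0] - Da[0,1]) v = u)
    (hT : D Tc v = (Complex.I * m) • v)
    (hZ1 : D (Matrix.single 0 0 𝐜 + Matrix.single 1 1 𝐜) v = μ₁ • v)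
    (hZ2 : D (Matrix.single 0 0 𝐜I + Matrix.single 1 1 𝐜I) v = μ₂ • v)
    (hC : ∑ i : Fin 2, ∑ j : Fin 2, Dh[i,j] (Dh[j,i] v) = lam • v) (y : ℝ) :
    2 * ℓ (A[y] (D Hc (D Hc v))) - (2 * μ₁ - 2 * m + 4) * ℓ (A[y] (D Hc v)) +
      (μ₁ ^ 2 - Complex.I * μ₁ * μ₂ - μ₂ ^ 2 / 2 + 2 * μ₁ + m ^ 2 / 2 - μ₁ * m - 2 * m - lam) * ℓ (A[y] v) +
        2 * ((θ₁ - Complex.I * θ₂) * (θ₁ + Complex.I * θ₂)) * (Real.exp y : ℂ) ^ 2 * ℓ (A[y] v) +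
          2 * (θ₁ - Complex.I * θ₂) * (Real.exp y : ℂ) * ℓ (A[y] u) = 0 := by
  -- `τ(E₀₀ ⊗ ic) v = ((μ₂ + im)/2) v`
  have hQ : D (Matrix.single 0 0 𝐜I) v = ((μ₂ + Complex.I * m) / 2) • v := by
    have hT' := hT
    rw [gardingEnd_sub, LinearMap.sub_apply] at hT'
    have hZ2' := hZ2
    rw [gardingEnd_add, LinearMap.add_apply] at hZ2'
    have h2 : (2 : ℂ) • D (Matrix.single 0 0 𝐜I) v = μ₂ • v + (Complex.I * m) • v := by
      rw [← hZ2', ← hT', two_smul]; abel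
    have h := congrArg (fun u => (2 : ℂ)⁻¹ • u) h2
    simp only [smul_smul, smul_add] at h
    rw [inv_mul_cancel₀ two_ne_zero, one_smul] at h
    rw [h, ← add_smul]
    congr 1
    ring
  have hM : Dh[1,0] v = Da[0,1] v + u := by
    rw [← hF]
    simp only [LinearMap.sub_apply, LinearMap.add_apply, LinearMap.smul_apply]
    abel
  -- `τ^h(E₀₀) v + τ^h(E₁₁) v = (μ₁ - iμ₂) v`
  have hZh : Dh[0,0] v + Dh[1,1] v = (μ₁ - Complex.I * μ₂) • v := by
    have h1 : D (Matrix.single 0 0 𝐜) v + D (Matrix.single 1 1 𝐜) v = μ₁ • v := by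
      rwa [gardingEnd_add, LinearMap.add_apply] at hZ1
    have h2 : D (Matrix.single 0 0 𝐜I) v + D (Matrix.single 1 1 𝐜I) v = μ₂ • v := by
      rwa [gardingEnd_add, LinearMap.add_apply] at hZ2
    simp only [LinearMap.sub_apply, LinearMap.smul_apply]
    rw [sub_smul, mul_smul, ← h1, ← h2, smul_add]
    abel
  have hcas := placeCasimirHol_apply_of_string hτ w (μ₁ - Complex.I * μ₂) v u hZh hM
  rw [hC] at hcas
  obtain ⟨hh, ha⟩ := gardingAct_expGLC_mul_hol01 (hcpt := hcpt) (τ := τ) hτ w y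
  have hQc : D (Matrix.single 0 0 𝐜I) * D Hc = D Hc * D (Matrix.single 0 0 𝐜I) := by
    rw [gardingEnd_mul_eq hτ, Matrix.single_mul_single_same, Matrix.single_mul_single_same,
      complexIdem_mul_complexIdemI, complexIdemI_mul_complexIdem, sub_self, gardingEnd_zero, add_zero]
  set H0 : Module.End ℂ (archGardingSpace hcpt τ) := Dh[0,0] with hH0d
  set Ph : Module.End ℂ (archGardingSpace hcpt τ) := Dh[0,1] with hPhd
  set P : Module.End ℂ (archGardingSpace hcpt τ) := Da[0,1] with hPd
  set q : ℂ := (μ₂ + Complex.I * m) / 2 with hq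
  have hH0 : H0 v = D Hc v - (Complex.I * q) • v := by
    rw [hH0d, LinearMap.sub_apply, LinearMap.smul_apply, hQ, smul_smul]
  have hH0sq : H0 (H0 v) = D Hc (D Hc v) - (2 * (Complex.I * q)) • D Hc v + ((Complex.I * q) * (Complex.I * q)) • v := by
    have hQH : D (Matrix.single 0 0 𝐜I) (D Hc v) = q • D Hc v := by
      have h := congrArg (fun T => T v) hQc
      simp only [Module.End.mul_apply] at h
      rw [h, hQ, map_smul]
    have hstep : H0 (D Hc v) = D Hc (D Hc v) - (Complex.I * q) • D Hc v := by
      rw [hH0d, LinearMap.sub_apply, LinearMap.smul_apply, hQH, smul_smul]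
    conv_lhs => rw [hH0]
    rw [map_sub, map_smul, hstep, hH0, smul_sub, smul_smul]
    module
  have hPhℓ : ∀ x : archGardingSpace hcpt τ, ℓ (Ph x) = (θ₁ - Complex.I * θ₂) * ℓ x := fun x => by
    rw [hPhd, LinearMap.sub_apply, LinearMap.smul_apply, map_sub, map_smul, hθ₁, hθ₂, smul_eq_mul]; ring
  have hXh : ∀ u : archGardingSpace hcpt τ, ℓ (A[y] (Ph u)) = (Real.exp y : ℂ) * (θ₁ - Complex.I * θ₂) * ℓ (A[y] u) := by
    intro u
    have h1 := congrArg (fun T => ℓ (T u)) hh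
    simp only [Module.End.mul_apply, LinearMap.smul_apply, map_smul, smul_eq_mul] at h1
    rw [h1, hPhℓ]; ring
  have hPℓ : ∀ x : archGardingSpace hcpt τ, ℓ (P x) = (θ₁ + Complex.I * θ₂) * ℓ x := fun x => by
    rw [hPd, LinearMap.add_apply, LinearMap.smul_apply, map_add, map_smul, hθ₁, hθ₂, smul_eq_mul]; ring
  have hXa : ∀ u : archGardingSpace hcpt τ, ℓ (A[y] (P u)) = (Real.exp y : ℂ) * (θ₁ + Complex.I * θ₂) * ℓ (A[y] u) := by
    intro u
    have h1 := congrArg (fun T => ℓ (T u)) ha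
    simp only [Module.End.mul_apply, LinearMap.smul_apply, map_smul, smul_eq_mul] at h1
    rw [h1, hPℓ]; ring
  have h := congrArg (fun u : archGardingSpace hcpt τ => ℓ (A[y] u)) hcas
  have hH0' := congrArg (fun u : archGardingSpace hcpt τ => ℓ (A[y] u)) hH0
  have hH0sq' := congrArg (fun u : archGardingSpace hcpt τ => ℓ (A[y] u)) hH0sq
  simp only [map_add, map_sub, map_smul, smul_eq_mul] at h hH0' hH0sq'
  simp only [hXa, hXh, hH0', hH0sq'] at h
  rw [hq] at h
  linear_combination -h + (2 * m * ℓ (A[y] (D Hc v)) +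
    (-(μ₂ ^ 2) / 2 + (1 - Complex.I ^ 2) * m ^ 2 / 2 - μ₁ * m - 2 * m) * ℓ (A[y] v)) * Complex.I_sq

end Place

end Literature.NumberTheory.Automorphic
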